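import Literature.Computability.Complexity.StackBricks
import Literature.Computability.Complexity.SearchToDecision
import Literature.Computability.Complexity.CookReducibilityTransitive
import HarnessLib

/-!
# String bricks in `FP`: tail, first symbol, un-pairing append, header fields, positional bit
access and bounded binary-to-unary conversion

Trunk `CplxCore`, toolkit in the algebra-of-`FP`-functions style (`comp_mem_FP`, `fanoutFn`,
`iteFn`, `iterate_mem_FP`, the projections `fstP`/`sndP` of `PRelHierarchy.lean`, `List.tail ∈ FP`
as `PRelSigma.tail_mem_FP`): the small total string
functions needed by brute-force evaluators (the first-order model-checking machine of Fagin's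
theorem, `Literature/ModelTheory/FiniteModelTheory/ESOVerifier.lean`):

* `take1Fn` (`List.take 1`, through `truncSndFn (C 1)` of `CoinTruncation.lean`) and
  concatenation of outputs `append_mem_FP` (via `appendFn ⟨a, b⟩ = a ++ b` of
  `SearchToDecision.lean`); the second unary field of a header `hdr n a z ↦ 1ᵃ` is the tree's
  `OracleCompose.midT` (`midT_eval_hdr`, `CookReducibilityTransitive.lean`) and is not re-declared;
* `bitAtFn ⟨a, b⟩ = (drop |a| b).take 1` — **the bit of `b` at the unary position `|a|`**
  (`dropSndFn X`, then `truncSndFn (C 1)`, then `sndP`: the `truncFn` pattern of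
  `CookReducibilityTransitive.lean`);
* `binToUnaryFn`: `⟨r, u⟩ ↦ 1^{min (⟦u⟧, |r|)}` — **the unary numeral of a binary numeral `u`,
  capped by the length of a ruler `r`** (clocked iteration, `|r|` rounds, of "if counter `< ⟦u⟧`
  then increment the binary counter (`addFn`, `ltFn` of `StackBricks.lean`) and emit a `1`").

All specifications are total equations on pair-coded arguments.

## References

* S. Arora, B. Barak, *Computational Complexity: A Modern Approach*, CUP 2009, §1.3 (polynomial
  time is closed under composition; finite control; counters), §1.4.1 (clocked loops).
-/

namespace Literature.Computability.Complexity

open _root_.Computability Brick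

/-! ### First symbol, concatenation -/


/-- `take1Fn = List.take 1`. [folklore] -/
def take1Fn : List Bool → List Bool := List.take 1

/-- **`take1Fn ∈ FP`**: it is `sndP ∘ truncSndFn (C 1) ∘ ⟨[], ·⟩` (`CoinTruncation.lean`).
[Arora–Barak 2009, §1.3] [cite: AroraBarakCC2009, §1.3] -/
theorem take1Fn_mem_FP : take1Fn ∈ FP := by
  have h : take1Fn = sndP ∘ truncSndFn (Polynomial.C 1) ∘ fanoutFn (fun _ => []) id := by
    funext w; simp [take1Fn, fanoutFn_apply, truncSndFn_boolPair, sndP]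
  rw [h]
  exact comp_mem_FP sndP_mem_FP (comp_mem_FP (truncSndFn_mem_FP _)
    (fanoutFn_mem_FP (const_mem_FP _) OracleCompose.id_mem_FP))

/-- Concatenating the outputs of two `FP` functions is in `FP` (`appendFn` of
`SearchToDecision.lean` after a fan-out). [Arora–Barak 2009, §1.3] [folklore] -/
theorem append_mem_FP {f g : List Bool → List Bool} (hf : f ∈ FP) (hg : g ∈ FP) :
    (fun z => f z ++ g z) ∈ FP := by
  have h : (fun z => f z ++ g z) = appendFn ∘ fanoutFn f g := by
    funext z; simp [Function.comp_apply, fanoutFn_apply]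
  rw [h]; exact comp_mem_FP appendFn_mem_FP (fanoutFn_mem_FP hf hg)

/-! ### Positional bit access -/

/-- **The bit at a unary position**: `bitAtFn ⟨a, b⟩ = (drop |a| b).take 1`, i.e. `[b[|a|]]`
if `|a| < |b|` and `[]` otherwise. [folklore] -/
noncomputable def bitAtFn : List Bool → List Bool :=
  sndP ∘ truncSndFn (Polynomial.C 1) ∘ dropSndFn Polynomial.X

/-- `bitAtFn (boolPair a b) = (b.drop |a|).take 1`. [folklore] -/
@[simp] theorem bitAtFn_boolPair (a b : List Bool) :
    bitAtFn (boolPair a b) = (b.drop a.length).take 1 := by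
  simp [bitAtFn, dropSndFn_boolPair, truncSndFn_boolPair]

/-- The bit at a position inside the string. [folklore] -/
theorem bitAtFn_boolPair_of_lt (a b : List Bool) (h : a.length < b.length) :
    bitAtFn (boolPair a b) = [b[a.length]] := by
  rw [bitAtFn_boolPair, List.take_one_drop_eq_of_lt_length h]
  simp

/-- **`bitAtFn ∈ FP`** (the pattern of `truncFn` of `CookReducibilityTransitive.lean`).
[Arora–Barak 2009, §1.3] [cite: AroraBarakCC2009, §1.3] -/
theorem bitAtFn_mem_FP : bitAtFn ∈ FP :=
  comp_mem_FP sndP_mem_FP (comp_mem_FP (truncSndFn_mem_FP _) (dropSndFn_mem_FP _))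

/-! ### Bounded binary-to-unary conversion -/

/-- The size of the canonical numeral is monotone under successor: `|bin (m+1)| ≤ |bin m| + 1`.
[folklore] -/
theorem length_encodeNat_succ_le (m : ℕ) : (encodeNat (m + 1)).length ≤ (encodeNat m).length + 1 := by
  rw [TM2Pass.length_encodeNat_eq_size, TM2Pass.length_encodeNat_eq_size]
  have h1 : m + 1 < 2 ^ (Nat.size m + 1) := by
    have := Nat.lt_size_self m; rw [pow_succ]; omega
  exact Nat.size_le.2 h1

/-- The fields of the conversion state `⟨r, ⟨u, ⟨c, acc⟩⟩⟩`: ruler (`fstP` of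
`PRelHierarchy.lean`), target numeral, binary counter, unary accumulator. [folklore] -/
def cvR : List Bool → List Bool := fstP
/-- target numeral of the conversion state (`fstP ∘ sndP`) [folklore] -/
def cvU : List Bool → List Bool := fstP ∘ sndP
/-- binary counter of the conversion state [folklore] -/
def cvC : List Bool → List Bool := fstP ∘ sndP ∘ sndP
/-- unary accumulator of the conversion state [folklore] -/
def cvA : List Bool → List Bool := sndP ∘ sndP ∘ sndP

/-- The fields are in `FP`. [folklore] -/
theorem cvR_mem_FP : cvR ∈ FP := fstP_mem_FP
/-- `cvU ∈ FP`. [folklore] -/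
theorem cvU_mem_FP : cvU ∈ FP := comp_mem_FP fstP_mem_FP sndP_mem_FP
/-- `cvC ∈ FP`. [folklore] -/
theorem cvC_mem_FP : cvC ∈ FP := comp_mem_FP fstP_mem_FP (comp_mem_FP sndP_mem_FP sndP_mem_FP)
/-- `cvA ∈ FP`. [folklore] -/
theorem cvA_mem_FP : cvA ∈ FP := comp_mem_FP sndP_mem_FP (comp_mem_FP sndP_mem_FP sndP_mem_FP)

/-- The update of one conversion round: increment the counter, emit a `1`. [folklore] -/
noncomputable def cvUpd : List Bool → List Bool :=
  fanoutFn cvR (fanoutFn cvU (fanoutFn (addFn ∘ fanoutFn cvC (fun _ => encodeNat 1))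
    (List.cons true ∘ cvA)))

/-- One conversion round: update if the counter is below the target. [folklore] -/
noncomputable def cvRound : List Bool → List Bool :=
  iteFn (ltFn ∘ fanoutFn cvC cvU) cvUpd id

/-- The conversion round on a state. [folklore] -/
theorem cvRound_state (r u c acc : List Bool) :
    cvRound (boolPair r (boolPair u (boolPair c acc))) =
      if bitsToNat c < bitsToNat u then
        boolPair r (boolPair u (boolPair (encodeNat (bitsToNat c + 1)) (true :: acc)))
      else boolPair r (boolPair u (boolPair c acc)) := by
  have hc : (ltFn ∘ fanoutFn cvC cvU) (boolPair r (boolPair u (boolPair c acc))) =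
      [decide (bitsToNat c < bitsToNat u)] := by
    simp [cvC, cvU, fstP, sndP, fanoutFn_apply]
  unfold cvRound
  rw [iteFn_apply hc]
  by_cases h : bitsToNat c < bitsToNat u
  · rw [decide_eq_true h, if_pos rfl, if_pos h]
    simp [cvUpd, cvR, cvU, cvC, cvA, fstP, sndP, fanoutFn_apply, bitsToNat_encodeNat]
  · rw [decide_eq_false h, if_neg h]
    simp

/-- Iterated conversion rounds from counter `bin m`, `m ≤ ⟦u⟧`, and accumulator `1ᵐ`.
[folklore] -/
theorem iterate_cvRound (k : ℕ) (r u : List Bool) (m : ℕ) (hm : m ≤ bitsToNat u) :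
    cvRound^[k] (boolPair r (boolPair u (boolPair (encodeNat m) (ones m)))) =
      boolPair r (boolPair u (boolPair (encodeNat (min (m + k) (bitsToNat u)))
        (ones (min (m + k) (bitsToNat u))))) := by
  induction k generalizing m with
  | zero => simp [Nat.min_eq_left hm]
  | succ k ih =>
    rw [Function.iterate_succ_apply, cvRound_state, bitsToNat_encodeNat]
    by_cases h : m < bitsToNat u
    · rw [if_pos h, show true :: ones m = ones (m + 1) by simp [ones, List.replicate_succ],
        ih (m + 1) h, show m + 1 + k = m + (k + 1) by ring]
    · have hm' : m = bitsToNat u := le_antisymm hm (not_lt.1 h)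
      rw [if_neg h, ih m hm]
      subst hm'
      simp

/-- `cvRound ∈ FP`. [folklore] -/
theorem cvRound_mem_FP : cvRound ∈ FP :=
  iteFn_mem_FP (comp_mem_FP ltFn_mem_FP (fanoutFn_mem_FP cvC_mem_FP cvU_mem_FP))
    (fanoutFn_mem_FP cvR_mem_FP (fanoutFn_mem_FP cvU_mem_FP (fanoutFn_mem_FP
      (comp_mem_FP addFn_mem_FP (fanoutFn_mem_FP cvC_mem_FP (const_mem_FP _)))
      (comp_mem_FP (cons_mem_FP true) cvA_mem_FP)))) OracleCompose.id_mem_FP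

/-- Additive growth of a conversion round (on every word). [folklore] -/
theorem length_cvRound_le (w : List Bool) : (cvRound w).length ≤ w.length + 12 := by
  have hc : (ltFn ∘ fanoutFn cvC cvU) w = [decide (bitsToNat (cvC w) < bitsToNat (cvU w))] := by
    simp [fanoutFn_apply]
  unfold cvRound
  rw [iteFn_apply hc]
  split_ifs
  · simp only [cvUpd, fanoutFn_apply, Function.comp_apply, length_boolPair, List.length_cons,
      addFn_boolPair, bitsToNat_encodeNat]
    have h0 := OracleCompose.length_boolUnpair_le w
    have h1 := OracleCompose.length_boolUnpair_le (boolUnpair w).2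
    have h2 := OracleCompose.length_boolUnpair_le (boolUnpair (boolUnpair w).2).2
    have h3 : (encodeNat (bitsToNat (cvC w) + 1)).length ≤ (cvC w).length + 1 :=
      (length_encodeNat_succ_le _).trans (Nat.succ_le_succ (Brick.length_encodeNat_bitsToNat_le _))
    simp only [cvR, cvU, cvC, cvA, fstP, sndP, Function.comp_apply] at *
    omega
  · simp

/-- The initial conversion state `⟨r, ⟨u, ⟨bin 0, 1⁰⟩⟩⟩` of an argument `⟨r, u⟩`. [folklore] -/
noncomputable def cvInit : List Bool → List Bool :=
  fanoutFn fstP (fanoutFn sndP (fun _ => boolPair [] []))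

/-- **Bounded binary-to-unary conversion** `binToUnaryFn ⟨r, u⟩ = 1^{min ⟦u⟧ |r|}`: the unary
numeral of the binary numeral `u`, capped by the length of the ruler `r` (so that the output
is never longer than the input). (The counted loop `loopStep`/`loopFn_mem_FP` of
`BrickAlgebra.lean` is not used: its step tests `isNil` on the counter, whereas the
specification here is wanted for arbitrary, possibly non-canonical numerals `u`, compared by
value with `ltFn`.) [Arora–Barak 2009, §1.3 (conversions between unary and binary)] [folklore] -/
noncomputable def binToUnaryFn : List Bool → List Bool :=
  cvA ∘ (fun w => cvRound^[(Polynomial.X : Polynomial ℕ).eval (boolUnpair w).1.length] w) ∘ cvInit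

/-- `binToUnaryFn (boolPair r u) = 1^{min ⟦u⟧ |r|}`. [folklore] -/
@[simp] theorem binToUnaryFn_boolPair (r u : List Bool) :
    binToUnaryFn (boolPair r u) = ones (min (bitsToNat u) r.length) := by
  have h0 : boolPair r (boolPair u (boolPair [] [])) =
      boolPair r (boolPair u (boolPair (encodeNat 0) (ones 0))) := by rfl
  simp only [binToUnaryFn, Function.comp_apply, cvInit, fanoutFn_apply, fstP_boolPair, sndP_boolPair,
    boolUnpair_boolPair, Polynomial.eval_X]
  rw [h0, iterate_cvRound _ r u 0 (Nat.zero_le _)]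
  simp [cvA, sndP, Nat.min_comm]

/-- **`binToUnaryFn ∈ FP`.** [Arora–Barak 2009, §1.3, §1.4.1] [cite: AroraBarakCC2009, §1.4.1] -/
theorem binToUnaryFn_mem_FP : binToUnaryFn ∈ FP :=
  comp_mem_FP cvA_mem_FP (comp_mem_FP (iterate_mem_FP cvRound_mem_FP 12 length_cvRound_le
    Polynomial.X) (fanoutFn_mem_FP fstP_mem_FP (fanoutFn_mem_FP sndP_mem_FP (const_mem_FP _))))

/-- The output of the conversion is never longer than the ruler. [folklore] -/
theorem length_binToUnaryFn_boolPair_le (r u : List Bool) :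
    (binToUnaryFn (boolPair r u)).length ≤ r.length := by
  rw [binToUnaryFn_boolPair]; simp [ones]

end Literature.Computability.Complexity
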